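import Literature.NumberTheory.PAdicHodge.AinfRamifiedTransportedPeriodHom
import Literature.NumberTheory.PAdicHodge.BmaxPlusFormalLogDivisionTowerElliptic
import Literature.NumberTheory.PAdicHodge.BmaxPlusToBdRPeriods
import HarnessLib

/-!
# The transported period map satisfies the Dieudonné–Honda relation and the honest (K₂) normal form VERBATIM:
# `φ²(P⁰τ) − a_p·φ(P⁰τ) + p·P⁰τ = 0` and `IsTeichLog k (p^M·(f(P⁰τ)·f(φΛ_u) − f(φP⁰τ)·f(Λ_u)))`

Topic `Literature/NumberTheory/PAdicHodge`; namespace `Literature.NumberTheory.PAdicHodge.AinfRamTop`. THEOREMS ONLY (no definition, no named fact, no instance,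
no `sorry`). Sequel of `AinfRamifiedTransportedPeriodHom` (T5a: `P⁰ = Λ_e ∘ [·̃] ∘ T : T_pŴ_D(𝒪_{ℂ_F}) →+ A_max`, characterised by `P⁰ τ = Λ_e(ι[w̃], z)` for every
transport `w` of `seqO τ` and every witness). Since the transports `w = Tτ` are EXACT `[p]_{E₀}`-division towers of the `ℤ`-curve `E₀` (good reduction at `p`:
`E₀ ⊗ ℚ_p`, `E₀ ⊗ 𝔽_p` elliptic), the φ-road's tower theorems apply to them without change:

* ★★ `transportedPeriod_honda` — **`φ²(P⁰τ) − ι(a_p(E₀))·φ(P⁰τ) + p·P⁰τ = 0` in `A_max`** for every `τ` (`frobBmaxPlus_hondaTrace_logSum_divisionLiftPt_eq_zero` at `Tτ`);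
  `logSum_transport_honda` — the same for the period `Λ_N(ι[ũ], z)` of ANY exact `[p]_{E₀}`-tower `u` (e.g. the transport of the Kummer tower of a rational point).
* ★★ `isTeichLog_transported_det` — **(K₂), honest form**: for every `τ`, every exact `E₀`-tower `u` with period `Λ_u`, and `k ≥ 1`: `∃ M`,
  `IsTeichLog k (p^M·(f(P⁰τ)·f(φΛ_u) − f(φ(P⁰τ))·f(Λ_u)))` (`f = bmaxPlusToBdR`; `BmaxPlusToBdRPeriods.isTeichLog_pow_mul_bmaxPlusToBdR_det_of_honda` for the
  Honda pair).

Purpose (crux K★ `stmt-BirchSwinnertonDyer-22226`, line `kato_lever`, memo `Lines/kato-lever-K2-ramified-cm-transport.md` §10.1, T5b-(i)): with the Hodge pair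
`Pω″ = emb A·f∘P⁰ + emb B·f∘φ∘P⁰`, `Pη = f∘P⁰` (or `f∘φ∘P⁰`) the capstone's resolution is `cL⁻¹·(Pη⊗bω″ − Pω″⊗bη) = ±(cL⁰)⁻¹·det⁰` with THIS determinant
(the ramified scalar cancels against the Legendre constant `cL = (−B)·cL⁰`), so the capstone's (K₂) hypothesis for the cells is exactly `isTeichLog_transported_det`
up to the `ℚ_p`-constant `cL⁰` (as in `BmaxPlusPhiRoadReciprocity.exists_forall_isTeichLog_pow_mul_qpToBdR_mul`). Infrastructure only; BSD / K★ are not proved by any of this.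

## References
* T. Honda, *On the theory of commutative formal groups*, J. Math. Soc. Japan 22 (1970), Thm. 2, Thm. 9. [Honda1970]
* P. Colmez, *Périodes p-adiques des variétés abéliennes*, Math. Ann. 292 (1992), §2. [Colmez1992PeriodesAbeliennes]
* N. M. Katz, *Crystalline cohomology, Dieudonné modules, and Jacobi sums* (1981), Thm. 5.1.4–5.1.5. [Katz1981CrystallineDieudonne]
-/

noncomputable section

open PowerSeries Filter Topology Field WittVector ValuativeRel
open scoped Classical

namespace Literature.NumberTheory.PAdicHodge

namespace AinfRamTop

open Literature.NumberTheory.GaloisRepresentations Literature.NumberTheory.GaloisRepresentations.IsNonarchimedeanLocalField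
open Literature.NumberTheory.GaloisRepresentations.LubinTate Literature.NumberTheory.EllipticCurves
open Literature.RingTheory.FormalGroups Literature.AlgebraicGeometry.Resolution GaloisContinuity

variable {F : Type} [Field F] [ValuativeRel F] [TopologicalSpace F] [IsNonarchimedeanLocalField F] [CharZero F]
  {p : ℕ} [hpp : Fact p.Prime] {hp : valuation F p < 1} (D : EisensteinRoot F p hp)
  [Fact (¬ IsUnit (p : integerC F))] [IsAdicComplete (Ideal.span {(p : integerC F)}) (integerC F)]
  {hθ : Function.Surjective (fontaineTheta (integerC F) p)}

set_option maxHeartbeats 1600000 in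
/-- ★ **Honda relation for the period of ANY exact `[p]_{E₀}`-tower** (in particular for the transports `Tτ`, `Tu` of the towers of a ramified good model `W_D ≡ E₀`):
`φ²Λ − ι(a_p)·φΛ + p·Λ = 0` for `Λ = Λ_N(ι[ũ], z)`, `E₀/ℤ` with `E₀ ⊗ ℚ_p`, `E₀ ⊗ 𝔽_p` elliptic. This is the tree's
`frobBmaxPlus_hondaTrace_logSum_divisionLiftPt_eq_zero`, recorded here in the transport's namespace. [cite: Honda1970, Thm. 2 and Thm. 9]
[cite: Colmez1992PeriodesAbeliennes, §2] -/
theorem logSum_transport_honda (E₀ : WeierstrassCurve ℤ) [(E₀.map (Int.castRingHom ℚ_[p])).IsElliptic] [(E₀.map (Int.castRingHom (ZMod p))).IsElliptic]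
    {u : ℕ → (maxNilIdealC F).toIdeal} (hu : ∀ n, AinfTop.mulPC F p E₀ (u (n + 1)) = u n) {N : ℕ} (hN : 1 ≤ N) {z : bmaxZero F p}
    (hz : algebraMap (Ainf (p := p) F) (bmaxZero F p) ((AinfTop.of F p).symm
      (((AinfTop.divisionLiftPt E₀ hθ u hu).val : (AinfTop.nilTheta F p hθ).toIdeal) : AinfTop F p)) ^ N = (p : bmaxZero F p) * z) :
    frobBmaxPlus F p (frobBmaxPlus F p
        (PadicLogSeries.logSum ((algebraMap (Ainf (p := p) F) (bmaxZero F p)).comp zpToAinf) (GaloisContinuity.formalLogNum E₀ p) N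
          (algebraMap (Ainf (p := p) F) (bmaxZero F p) ((AinfTop.of F p).symm
            (((AinfTop.divisionLiftPt E₀ hθ u hu).val : (AinfTop.nilTheta F p hθ).toIdeal) : AinfTop F p))) z)) -
      AdicCompletion.of (Ideal.span {(p : bmaxZero F p)}) (bmaxZero F p)
          (((algebraMap (Ainf (p := p) F) (bmaxZero F p)).comp zpToAinf) ((HasseManin.tr (E₀.map (Int.castRingHom (ZMod p))) : ℤ) : ℤ_[p])) *
        frobBmaxPlus F p
          (PadicLogSeries.logSum ((algebraMap (Ainf (p := p) F) (bmaxZero F p)).comp zpToAinf) (GaloisContinuity.formalLogNum E₀ p) N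
            (algebraMap (Ainf (p := p) F) (bmaxZero F p) ((AinfTop.of F p).symm
              (((AinfTop.divisionLiftPt E₀ hθ u hu).val : (AinfTop.nilTheta F p hθ).toIdeal) : AinfTop F p))) z) +
      AdicCompletion.of (Ideal.span {(p : bmaxZero F p)}) (bmaxZero F p) (p : bmaxZero F p) *
        PadicLogSeries.logSum ((algebraMap (Ainf (p := p) F) (bmaxZero F p)).comp zpToAinf) (GaloisContinuity.formalLogNum E₀ p) N
          (algebraMap (Ainf (p := p) F) (bmaxZero F p) ((AinfTop.of F p).symm
            (((AinfTop.divisionLiftPt E₀ hθ u hu).val : (AinfTop.nilTheta F p hθ).toIdeal) : AinfTop F p))) z = 0 :=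
  AinfTop.frobBmaxPlus_hondaTrace_logSum_divisionLiftPt_eq_zero E₀ (hθ := hθ) hu hN hz

set_option maxHeartbeats 1600000 in
/-- ★★ **The transported period map satisfies the Honda relation**: for `P⁰` as in `exists_transportedPeriodHom` (characterised on every transport) and every
`τ ∈ T_pŴ_D(𝒪_{ℂ_F})`: `φ²(P⁰τ) − ι(a_p(E₀))·φ(P⁰τ) + p·P⁰τ = 0` in `A_max` (`p` read through `B⁰_max → A_max`).
[cite: Honda1970, Thm. 2 and Thm. 9] [cite: Katz1981CrystallineDieudonne, Thm. 5.1.4–5.1.5] -/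
theorem transportedPeriod_honda (W : WeierstrassCurve (EisensteinRoot.CoeffDisc D)) (E₀ : WeierstrassCurve ℤ)
    [(E₀.map (Int.castRingHom ℚ_[p])).IsElliptic] [(E₀.map (Int.castRingHom (ZMod p))).IsElliptic]
    (hWE : W.map (Ideal.Quotient.mk (Ideal.span {EisensteinRoot.CoeffDisc.of D (AdjoinRoot.root D.poly)})) =
      (E₀.map (algebraMap ℤ (EisensteinRoot.CoeffDisc D))).map
        (Ideal.Quotient.mk (Ideal.span {EisensteinRoot.CoeffDisc.of D (AdjoinRoot.root D.poly)})))
    (ψ : EisensteinRoot.CoeffDisc D →+* LTCoeff F) (hψ : ∀ c, algebraMap (LTCoeff F) F (ψ c) = EisensteinRoot.CoeffDisc.toF D c)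
    (P0 : AinfTop.TatePtO F (W.map ψ) p →+ BmaxPlus F p)
    (hP0 : ∀ (τ : AinfTop.TatePtO F (W.map ψ) p) (w : ℕ → (maxNilIdealC F).toIdeal) (hw : ∀ n, AinfTop.mulPC F p E₀ (w (n + 1)) = w n),
        (∀ n, ‖(((w n : (maxNilIdealC F).toIdeal) : CBall F) : CompletedAlgClosure F) -
          (((AinfTop.seqO (W.map ψ) τ n : (maxNilIdealC F).toIdeal) : CBall F) : CompletedAlgClosure F)‖ ≤
            ‖((D.rootC : integerC F) : CompletedAlgClosure F)‖) →
        ∀ z : bmaxZero F p,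
          algebraMap (Ainf (p := p) F) (bmaxZero F p) ((AinfTop.of F p).symm
              (((AinfTop.divisionLiftPt E₀ hθ w hw).val : (AinfTop.nilTheta F p hθ).toIdeal) : AinfTop F p)) ^ D.e = (p : bmaxZero F p) * z →
          P0 τ = PadicLogSeries.logSum ((algebraMap (Ainf (p := p) F) (bmaxZero F p)).comp zpToAinf) (GaloisContinuity.formalLogNum E₀ p) D.e
            (algebraMap (Ainf (p := p) F) (bmaxZero F p) ((AinfTop.of F p).symm
              (((AinfTop.divisionLiftPt E₀ hθ w hw).val : (AinfTop.nilTheta F p hθ).toIdeal) : AinfTop F p))) z)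
    (τ : AinfTop.TatePtO F (W.map ψ) p) :
    frobBmaxPlus F p (frobBmaxPlus F p (P0 τ)) -
      AdicCompletion.of (Ideal.span {(p : bmaxZero F p)}) (bmaxZero F p)
          (((algebraMap (Ainf (p := p) F) (bmaxZero F p)).comp zpToAinf) ((HasseManin.tr (E₀.map (Int.castRingHom (ZMod p))) : ℤ) : ℤ_[p])) *
        frobBmaxPlus F p (P0 τ) +
      AdicCompletion.of (Ideal.span {(p : bmaxZero F p)}) (bmaxZero F p) (p : bmaxZero F p) * P0 τ = 0 := by
  -- a transport `w` of `seqO τ`, its depth and a witness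
  obtain ⟨w, ⟨hw, hwτ⟩, -⟩ := exists_unique_int_divisionSeq_of_ramified D W E₀ hWE (mulPC_seqO W ψ hψ τ)
  have hdepth : ‖(((w 0 : (maxNilIdealC F).toIdeal) : CBall F) : CompletedAlgClosure F)‖ ^ D.e ≤ ‖(p : CompletedAlgClosure F)‖ :=
    norm_transport_zero_pow_le D (AinfTop.seqO_zero (W.map ψ) τ) hwτ
  have hmem := AinfTop.pow_coe_val_nsmul_divisionLiftPt_mem E₀ (hθ := hθ) hw hdepth 1
  rw [one_nsmul] at hmem
  obtain ⟨z, hz⟩ := exists_algebraMap_pow_eq_natCast_mul hmem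
  rw [hP0 τ w hw hwτ z hz]
  exact logSum_transport_honda (hθ := hθ) E₀ hw D.e_pos hz

set_option maxHeartbeats 1600000 in
/-- ★★ **(K₂) in honest form for the transported pair**: for `P⁰` as above, every `τ ∈ T_pŴ_D`, every exact `[p]_{E₀}`-tower `u` (e.g. the transport of the
Kummer tower of a rational point) with period `Λ_u = Λ_N(ι[ũ], z)`, and `k ≥ 1`: there is `M` with
`IsTeichLog k (p^M·(f(P⁰τ)·f(φΛ_u) − f(φ(P⁰τ))·f(Λ_u)))`, `f = bmaxPlusToBdR` — the resolution of the capstone is a `B_dR⁺`-unit multiple of this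
determinant (the ramified Hodge scalar cancels against the Legendre constant). [cite: Colmez1992PeriodesAbeliennes, §2] [cite: Honda1970, Thm. 2] -/
theorem isTeichLog_transported_det (hpv : valuation F p < 1) (W : WeierstrassCurve (EisensteinRoot.CoeffDisc D)) (E₀ : WeierstrassCurve ℤ)
    [(E₀.map (Int.castRingHom ℚ_[p])).IsElliptic] [(E₀.map (Int.castRingHom (ZMod p))).IsElliptic]
    (hWE : W.map (Ideal.Quotient.mk (Ideal.span {EisensteinRoot.CoeffDisc.of D (AdjoinRoot.root D.poly)})) =
      (E₀.map (algebraMap ℤ (EisensteinRoot.CoeffDisc D))).map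
        (Ideal.Quotient.mk (Ideal.span {EisensteinRoot.CoeffDisc.of D (AdjoinRoot.root D.poly)})))
    (ψ : EisensteinRoot.CoeffDisc D →+* LTCoeff F) (hψ : ∀ c, algebraMap (LTCoeff F) F (ψ c) = EisensteinRoot.CoeffDisc.toF D c)
    (P0 : AinfTop.TatePtO F (W.map ψ) p →+ BmaxPlus F p)
    (hP0 : ∀ (τ : AinfTop.TatePtO F (W.map ψ) p) (w : ℕ → (maxNilIdealC F).toIdeal) (hw : ∀ n, AinfTop.mulPC F p E₀ (w (n + 1)) = w n),
        (∀ n, ‖(((w n : (maxNilIdealC F).toIdeal) : CBall F) : CompletedAlgClosure F) -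
          (((AinfTop.seqO (W.map ψ) τ n : (maxNilIdealC F).toIdeal) : CBall F) : CompletedAlgClosure F)‖ ≤
            ‖((D.rootC : integerC F) : CompletedAlgClosure F)‖) →
        ∀ z : bmaxZero F p,
          algebraMap (Ainf (p := p) F) (bmaxZero F p) ((AinfTop.of F p).symm
              (((AinfTop.divisionLiftPt E₀ hθ w hw).val : (AinfTop.nilTheta F p hθ).toIdeal) : AinfTop F p)) ^ D.e = (p : bmaxZero F p) * z →
          P0 τ = PadicLogSeries.logSum ((algebraMap (Ainf (p := p) F) (bmaxZero F p)).comp zpToAinf) (GaloisContinuity.formalLogNum E₀ p) D.e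
            (algebraMap (Ainf (p := p) F) (bmaxZero F p) ((AinfTop.of F p).symm
              (((AinfTop.divisionLiftPt E₀ hθ w hw).val : (AinfTop.nilTheta F p hθ).toIdeal) : AinfTop F p))) z)
    (τ : AinfTop.TatePtO F (W.map ψ) p)
    {u : ℕ → (maxNilIdealC F).toIdeal} (hu : ∀ n, AinfTop.mulPC F p E₀ (u (n + 1)) = u n) {N : ℕ} (hN : 1 ≤ N) {zu : bmaxZero F p}
    (hzu : algebraMap (Ainf (p := p) F) (bmaxZero F p) ((AinfTop.of F p).symm
      (((AinfTop.divisionLiftPt E₀ hθ u hu).val : (AinfTop.nilTheta F p hθ).toIdeal) : AinfTop F p)) ^ N = (p : bmaxZero F p) * zu)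
    {k : ℕ} (hk : 1 ≤ k) :
    ∃ M : ℕ, IsTeichLog k ((p : BDeRhamPlus (integerC F) p) ^ M *
      (bmaxPlusToBdR F p (P0 τ) *
          bmaxPlusToBdR F p (frobBmaxPlus F p
            (PadicLogSeries.logSum ((algebraMap (Ainf (p := p) F) (bmaxZero F p)).comp zpToAinf) (GaloisContinuity.formalLogNum E₀ p) N
              (algebraMap (Ainf (p := p) F) (bmaxZero F p) ((AinfTop.of F p).symm
                (((AinfTop.divisionLiftPt E₀ hθ u hu).val : (AinfTop.nilTheta F p hθ).toIdeal) : AinfTop F p))) zu)) -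
        bmaxPlusToBdR F p (frobBmaxPlus F p (P0 τ)) *
          bmaxPlusToBdR F p
            (PadicLogSeries.logSum ((algebraMap (Ainf (p := p) F) (bmaxZero F p)).comp zpToAinf) (GaloisContinuity.formalLogNum E₀ p) N
              (algebraMap (Ainf (p := p) F) (bmaxZero F p) ((AinfTop.of F p).symm
                (((AinfTop.divisionLiftPt E₀ hθ u hu).val : (AinfTop.nilTheta F p hθ).toIdeal) : AinfTop F p))) zu))) := by
  have hofp : AdicCompletion.of (Ideal.span {(p : bmaxZero F p)}) (bmaxZero F p) (p : bmaxZero F p) = (p : BmaxPlus F p) :=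
    map_natCast (algebraMap (bmaxZero F p) (BmaxPlus F p)) p
  have h1 := transportedPeriod_honda D (hθ := hθ) W E₀ hWE ψ hψ P0 hP0 τ
  have h2 := logSum_transport_honda (hθ := hθ) E₀ hu hN hzu
  rw [hofp] at h1 h2
  exact isTeichLog_pow_mul_bmaxPlusToBdR_det_of_honda hθ hpv hk h1 h2

end AinfRamTop

end Literature.NumberTheory.PAdicHodge
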